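import Literature.NumberTheory.EllipticCurves.TunnellWaldspurgerSymmetricFamilyProofs
import Literature.NumberTheory.EllipticCurves.TunnellConverseEvenOfWaldspurgerProofs
import HarnessLib

/-!
# `tunnell_converse_even` from two SIGNED symmetric families

[[cite: Tunnell1983Congruent, proof of Thm 3, p. 329, ll. 22–27]] and
[[cite: Kohnen1985, §1, proof of Cor. 1 (the symmetry of `r(f; D, D')`)]] — the endgame of the
level-`256` Shintani-lift route to `Literature.NumberTheory.EllipticCurves.tunnell_converse_even`:
the sibling lemma `exists_sq_propto_of_symmetricFamily` is stated for an ABSTRACT coefficient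
function `c`, and the trivial-character lift of `φ₆₄` delivers, on each class mod `8`,
coefficients proportional to the RE-SIGNED Tunnell coefficients `s(m) b(m)` (`s(m) = ±1`
depending on `m mod 16`), not to `b(m)` itself.  Since `s(D)² = 1` the conclusion
`b(D)² ∝ L(E_{2D}, 1) √D` is unchanged: we PROVE
**`Tunnell1983_b_sq_propto_L_one_of_signedFamilies`** and
**`tunnell_converse_even_of_signedFamilies`** (via `tunnell_converse_even_of_propto`).

No named facts, no new definitions.
-/

noncomputable section

open UpperHalfPlane hiding I
open Complex
open scoped NumberTheorySymbols

namespace Literature.NumberTheory.EllipticCurves.Tunnell1983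

open Literature.NumberTheory.EllipticCurves.ModularForms

/-- **`Tunnell1983_b_sq_propto_L_one` from two SIGNED symmetric families**: as
`Tunnell1983_b_sq_propto_L_one_of_symmetricFamilies`, but hypothesis (H1) reads
`R(D, m) = A_D · s(m) b(m)` with a sign `s(m) = ±1` (this is the shape delivered by the
trivial-character Shintani lift of level `256`, whose coefficients on a class mod `8` are the
re-signed Tunnell coefficients); the conclusion is unchanged since `s(D)² = 1`.
[cite: Tunnell1983Congruent, proof of Thm 3, p. 329, ll. 22–27] [cite: Kohnen1985, §1, proof of Cor. 1] -/
theorem Tunnell1983_b_sq_propto_L_one_of_signedFamilies (R₁ R₅ : ℕ → ℕ → ℂ) (s : ℕ → ℂ)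
    (hs : ∀ m : ℕ, s m ^ 2 = 1) {κ₁ κ₅ : ℂ} (hκ₁ : κ₁ ≠ 0) (hκ₅ : κ₅ ≠ 0)
    (hA₁ : ∀ ⦃D : ℕ⦄, Squarefree D → D % 8 = 1 →
      ∃ A : ℂ, ∀ ⦃m : ℕ⦄, m % 8 = 1 → R₁ D m = A * (s m * (b m : ℂ)))
    (hsymm₁ : ∀ ⦃D : ℕ⦄, Squarefree D → D % 8 = 1 → R₁ D 1 = R₁ 1 D)
    (hdiag₁ : ∀ ⦃D : ℕ⦄, Squarefree D → D % 8 = 1 →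
      (congruentNumberCurve (2 * D)).HasEntireLFunction →
      R₁ D D = κ₁ * (congruentNumberCurve (2 * D)).entireLFunction 1 * (Real.sqrt D : ℂ))
    (hA₅ : ∀ ⦃D : ℕ⦄, Squarefree D → D % 8 = 5 →
      ∃ A : ℂ, ∀ ⦃m : ℕ⦄, m % 8 = 5 → R₅ D m = A * (s m * (b m : ℂ)))
    (hsymm₅ : ∀ ⦃D : ℕ⦄, Squarefree D → D % 8 = 5 → R₅ D 5 = R₅ 5 D)
    (hdiag₅ : ∀ ⦃D : ℕ⦄, Squarefree D → D % 8 = 5 →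
      (congruentNumberCurve (2 * D)).HasEntireLFunction →
      R₅ D D = κ₅ * (congruentNumberCurve (2 * D)).entireLFunction 1 * (Real.sqrt D : ℂ)) :
    Tunnell1983_b_sq_propto_L_one := by
  have hL := @hasEntireLFunction_congruentNumberCurve_holds
  have h5 : Squarefree 5 := (Nat.prime_five).prime.squarefree
  obtain ⟨c₁, hc₁⟩ := exists_sq_propto_of_symmetricFamily R₁ (fun m ↦ s m * (b m : ℂ))
    (fun D ↦ (congruentNumberCurve (2 * D)).entireLFunction 1)
    (fun D ↦ (congruentNumberCurve (2 * D)).HasEntireLFunction) hκ₁ squarefree_one rfl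
    (hL (squarefree_two_mul_of_odd squarefree_one odd_one))
    entireLFunction_congruentNumberCurve_two_one_ne_zero hA₁ hsymm₁ hdiag₁
  obtain ⟨c₅, hc₅⟩ := exists_sq_propto_of_symmetricFamily R₅ (fun m ↦ s m * (b m : ℂ))
    (fun D ↦ (congruentNumberCurve (2 * D)).entireLFunction 1)
    (fun D ↦ (congruentNumberCurve (2 * D)).HasEntireLFunction) hκ₅ h5 rfl
    (hL (squarefree_two_mul_of_odd h5 (by decide)))
    entireLFunction_congruentNumberCurve_ten_one_ne_zero hA₅ hsymm₅ hdiag₅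
  have hsq : ∀ D : ℕ, (s D * (b D : ℂ)) ^ 2 = (b D : ℂ) ^ 2 := fun D ↦ by rw [mul_pow, hs, one_mul]
  refine ⟨c₁, c₅, fun D hD hLD ↦ ⟨fun h1 ↦ ?_, fun h5' ↦ ?_⟩⟩
  · rw [← hsq]; exact hc₁ hD h1 hLD
  · rw [← hsq]; exact hc₅ hD h5' hLD

/-- **`tunnell_converse_even` from two signed symmetric families.** [cite: KoblitzECMF1993, Ch. IV §4] -/
theorem tunnell_converse_even_of_signedFamilies (R₁ R₅ : ℕ → ℕ → ℂ) (s : ℕ → ℂ)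
    (hs : ∀ m : ℕ, s m ^ 2 = 1) {κ₁ κ₅ : ℂ} (hκ₁ : κ₁ ≠ 0) (hκ₅ : κ₅ ≠ 0)
    (hA₁ : ∀ ⦃D : ℕ⦄, Squarefree D → D % 8 = 1 →
      ∃ A : ℂ, ∀ ⦃m : ℕ⦄, m % 8 = 1 → R₁ D m = A * (s m * (b m : ℂ)))
    (hsymm₁ : ∀ ⦃D : ℕ⦄, Squarefree D → D % 8 = 1 → R₁ D 1 = R₁ 1 D)
    (hdiag₁ : ∀ ⦃D : ℕ⦄, Squarefree D → D % 8 = 1 →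
      (congruentNumberCurve (2 * D)).HasEntireLFunction →
      R₁ D D = κ₁ * (congruentNumberCurve (2 * D)).entireLFunction 1 * (Real.sqrt D : ℂ))
    (hA₅ : ∀ ⦃D : ℕ⦄, Squarefree D → D % 8 = 5 →
      ∃ A : ℂ, ∀ ⦃m : ℕ⦄, m % 8 = 5 → R₅ D m = A * (s m * (b m : ℂ)))
    (hsymm₅ : ∀ ⦃D : ℕ⦄, Squarefree D → D % 8 = 5 → R₅ D 5 = R₅ 5 D)
    (hdiag₅ : ∀ ⦃D : ℕ⦄, Squarefree D → D % 8 = 5 →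
      (congruentNumberCurve (2 * D)).HasEntireLFunction →
      R₅ D D = κ₅ * (congruentNumberCurve (2 * D)).entireLFunction 1 * (Real.sqrt D : ℂ)) :
    Literature.NumberTheory.EllipticCurves.tunnell_converse_even :=
  tunnell_converse_even_of_propto (Tunnell1983_b_sq_propto_L_one_of_signedFamilies R₁ R₅ s hs
    hκ₁ hκ₅ hA₁ hsymm₁ hdiag₁ hA₅ hsymm₅ hdiag₅)

end Literature.NumberTheory.EllipticCurves.Tunnell1983
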